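import Literature.AlgebraicGeometry.HodgeTheory.OrdinaryDoublePointSliceCriterion
import Literature.AlgebraicGeometry.HodgeTheory.SymmetricA3AxisMember
import Literature.AlgebraicGeometry.HodgeTheory.SymmetricA3EquivariantSlice
import Literature.AlgebraicGeometry.HodgeTheory.NodalFormPencilNonsingular
import HarnessLib

/-!
# Nodes of the symmetric `A₃` unfolding read in a slice chart: a critical zero of the reduced function with
# non-zero second `u`-derivative is an ordinary double point (programme B2-BIF, node checks S6)

Family `hodge`, layer `Literature/AlgebraicGeometry/HodgeTheory`, sequel of `OrdinaryDoublePointSliceCriterion` (the kernel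
criterion and the Schur step for `IsOrdinaryDoublePointOf`) and companion of `SymmetricA3ReducedChart` (the reduced chart
`xs : D → ℂⁿ⁺²` of the symmetric `A₃` unfolding `F_{αβ} = f₁ + α g₂ + β g₀`: `xs(p)_j = 1`, `xs(p)_k = u`,
`∂ᵢF_{αβ}(xs(p)) = 0` for `i ∉ {j,k}`, analytic on an open `D`).  Written by the prover seat `hodge-nonav-19716-p2` (g8,
cell `hodge-nonav`) for the node clauses of `IsSymmetricA3Bifurcation` (binder hB2 `picardLefschetz_symmetricA3` of crux
K1-B of `Summits/HodgeConjecture/HodgeConjecture/Theses/SignSymmetricPowers.lean`, stmt-HodgeConjecture-19716; AGZV II §5.2: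
the singular members `λ₂ = 0`, `λ₁² = 4λ₂` of the boundary singularity `B₂` have non-degenerate critical points).

The statements take the chart as HYPOTHESES in the shape of the conjuncts of `IsSymmetricA3Datum.exists_reducedChart`
(so they apply to that chart, and to any other slice chart with the same three properties):

* `hasDerivAt_eval_chart` — chain rule along the chart: `d/du G(xs(μ, u)) = Σ_l ∂_lG(xs) · ∂ᵤxs_l`;
* `hessianAt_mulVec_chartDeriv` — for `w = ∂ᵤ xs(μ, u₀)`: `w_j = 0`, `w_k = 1`, the rows `i ∉ {j, k}` of
  `Hess(F_μ)(xs) · w` vanish, and the row `k` is `d/du (∂ₖF_μ(xs(μ, u)))` at `u₀` (implicit differentiation of the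
  slice equations);
* `isOrdinaryDoublePointOf_chart` — **if `F_μ(xs(p)) = 0`, `∂ₖF_μ(xs(p)) = 0`, the `(∉{j,k})`-block of `Hess(F_μ)(xs(p))`
  has non-zero determinant and `d/du (∂ₖF_μ ∘ xs)(p) ≠ 0`, then `xs(p)` is an ordinary double point of `F_μ`** (all
  partials vanish by `slice_singular_iff`; rank `n + 1` by `isOrdinaryDoublePointOf_of_schur`);
* `eventually_det_block_hessianAt_chart_ne_zero` — the block determinant is non-zero for `p` near `0` (it is
  non-zero at `(e_j, f₁)` by `IsSymmetricA3Datum.det_block_hessianAt_ne_zero`, and continuous).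

## References
* [ArnoldGuseinzadeVarchenko2012] AGZV II, Part I §5.2 (pp. 132–133: the members `λ₂ = 0` and `λ₁² = 4λ₂` of `B₂`).
* [VoisinHodgeII2003] Voisin II, §2.1.1 Lemma 2.7, Cor. 2.8; §2.3.1 (ordinary double points).
-/

noncomputable section

open MvPolynomial Metric Set Filter
open scoped Topology
open Literature.AlgebraicGeometry.Motives

namespace Literature.AlgebraicGeometry.HodgeTheory

open DiscriminantBranches

section HodgeTheory

variable {n d : ℕ}

/-- **Chain rule along a curve**: for a polynomial `G` and a curve `c` with derivative `w` at `u₀`,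
`d/du G(c(u)) = Σ_l ∂_lG(c(u₀)) w_l` at `u₀`. [folklore] [cite: VoisinHodgeII2003, §2.1.1] -/
theorem hasDerivAt_eval_comp (G : MvPolynomial (Fin (n + 2)) ℂ) {c : ℂ → (Fin (n + 2) → ℂ)} {u₀ : ℂ}
    {w : Fin (n + 2) → ℂ} (hc : HasDerivAt c w u₀) :
    HasDerivAt (fun u => eval (c u) G) (∑ l, eval (c u₀) (pderiv l G) * w l) u₀ := by
  have h := (hasFDerivAt_mvPolynomial_eval G (c u₀)).comp_hasDerivAt u₀ hc
  rw [evalDeriv_apply] at h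
  exact h

variable {f₁ g₀ g₂ : MvPolynomial (Fin (n + 2)) ℂ} {j k : Fin (n + 2)}
  {D : Set ((ℂ × ℂ) × ℂ)} {xs : (ℂ × ℂ) × ℂ → (Fin (n + 2) → ℂ)}

/-- **Implicit differentiation of the slice equations along a slice chart.**  Let `xs` be differentiable on an open
`D` with `xs(p)_j = 1`, `xs(p)_k = u` and `∂ᵢF_μ(xs(p)) = 0` for `i ∉ {j, k}` (`F_μ = f₁ + α g₂ + β g₀`, `p = (μ, u)`).
For `p = (μ, u₀) ∈ D` let `w = ∂ᵤ xs(μ, ·)(u₀)`.  Then `w_j = 0`, `w_k = 1`, the rows `i ∉ {j, k}` of `Hess(F_μ)(xs(p))·w`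
vanish, and its row `k` is the `u`-derivative of `∂ₖF_μ(xs(μ, u))` at `u₀`.
[cite: VoisinHodgeII2003, §2.1.1 Lemma 2.7] [cite: ArnoldGuseinzadeVarchenko2012, Part I §5.2] -/
theorem hessianAt_mulVec_chartDeriv (hDo : IsOpen D) (hxs : DifferentiableOn ℂ xs D)
    (hchart : ∀ p ∈ D, xs p j = 1 ∧ xs p k = p.2 ∧
      ∀ i, i ≠ j → i ≠ k → eval (xs p) (pderiv i (f₁ + p.1.1 • g₂ + p.1.2 • g₀)) = 0)
    {p : (ℂ × ℂ) × ℂ} (hp : p ∈ D) :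
    let w : Fin (n + 2) → ℂ := deriv (fun u => xs (p.1, u)) p.2
    w j = 0 ∧ w k = 1 ∧
      (∀ i, i ≠ j → i ≠ k → (hessianAt (f₁ + p.1.1 • g₂ + p.1.2 • g₀) (xs p)).mulVec w i = 0) ∧
      (hessianAt (f₁ + p.1.1 • g₂ + p.1.2 • g₀) (xs p)).mulVec w k =
        deriv (fun u => eval (xs (p.1, u)) (pderiv k (f₁ + p.1.1 • g₂ + p.1.2 • g₀))) p.2 := by
  intro w
  set F := f₁ + p.1.1 • g₂ + p.1.2 • g₀ with hF
  -- the curve `u ↦ xs (μ, u)` and its derivative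
  have hnhds : ∀ᶠ u in 𝓝 p.2, ((p.1, u) : (ℂ × ℂ) × ℂ) ∈ D := by
    have hc : Continuous fun u : ℂ => ((p.1, u) : (ℂ × ℂ) × ℂ) := by fun_prop
    exact hc.continuousAt.eventually_mem (hDo.mem_nhds (by simpa using hp))
  have hcd : DifferentiableAt ℂ (fun u => xs (p.1, u)) p.2 := by
    have h1 : DifferentiableAt ℂ xs (p.1, p.2) := hxs.differentiableAt (hDo.mem_nhds (by simpa using hp))
    exact h1.comp p.2 ((differentiableAt_const _).prodMk differentiableAt_id)
  have hcurve : HasDerivAt (fun u => xs (p.1, u)) w p.2 := hcd.hasDerivAt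
  -- coordinates of `w`
  have hwcoord : ∀ i, HasDerivAt (fun u => xs (p.1, u) i) (w i) p.2 := fun i => (hasDerivAt_pi.1 hcurve) i
  have hwj : w j = 0 := by
    have h1 : HasDerivAt (fun u => xs (p.1, u) j) 0 p.2 := by
      refine (hasDerivAt_const p.2 (1 : ℂ)).congr_of_eventuallyEq ?_
      filter_upwards [hnhds] with u hu
      exact (hchart _ hu).1
    exact (hwcoord j).unique h1
  have hwk : w k = 1 := by
    have h1 : HasDerivAt (fun u => xs (p.1, u) k) 1 p.2 := by
      refine (hasDerivAt_id p.2).congr_of_eventuallyEq ?_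
      filter_upwards [hnhds] with u hu
      exact (hchart _ hu).2.1
    exact (hwcoord k).unique h1
  -- the rows of `Hess · w` are the `u`-derivatives of the partials along the curve
  have hrow : ∀ i, HasDerivAt (fun u => eval (xs (p.1, u)) (pderiv i F)) ((hessianAt F (xs p)).mulVec w i) p.2 := by
    intro i
    have h := hasDerivAt_eval_comp (pderiv i F) hcurve
    have heq : ∑ l, eval (xs (p.1, p.2)) (pderiv l (pderiv i F)) * w l = (hessianAt F (xs p)).mulVec w i := by
      rw [Matrix.mulVec, dotProduct]
      refine Finset.sum_congr rfl fun l _ => ?_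
      rw [hessianAt_comm]
      rfl
    rw [heq] at h
    exact h
  refine ⟨hwj, hwk, fun i hij hik => ?_, ?_⟩
  · have h0 : HasDerivAt (fun u => eval (xs (p.1, u)) (pderiv i F)) 0 p.2 := by
      refine (hasDerivAt_const p.2 (0 : ℂ)).congr_of_eventuallyEq ?_
      filter_upwards [hnhds] with u hu
      exact (hchart _ hu).2.2 i hij hik
    exact (hrow i).unique h0
  · exact ((hrow k).deriv).symm

/-- **A critical zero of the reduced function with non-zero second `u`-derivative is an ordinary double point.**
With a slice chart `xs` as above (forms `f₁, g₀, g₂` of degree `d`, symmetric `A₃` datum for `j ≠ k` and `d ≠ 0`):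
if at `p = (μ, u₀) ∈ D` the member `F_μ` vanishes at `xs(p)` together with `∂ₖF_μ`, the `(∉{j,k})`-block of
`Hess(F_μ)(xs(p))` has non-zero determinant, and `d/du ∂ₖF_μ(xs(μ, u)) ≠ 0` at `u₀` (for the reduced function
`r = F_μ ∘ xs` this is `∂ᵤ²r ≠ 0`, since `∂ᵤr = ∂ₖF_μ ∘ xs`), then `xs(p)` is an ordinary double point of `F_μ`.
[cite: ArnoldGuseinzadeVarchenko2012, Part I §5.2 (pp. 132–133)] [cite: VoisinHodgeII2003, §2.1.1 Lemma 2.7, Cor. 2.8] -/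
theorem isOrdinaryDoublePointOf_chart {a : Fin (n + 2) → ℂˣ} (hf₁ : f₁.IsHomogeneous d) (hg₀ : g₀.IsHomogeneous d)
    (hg₂ : g₂.IsHomogeneous d) (hD : IsSymmetricA3Datum f₁ g₀ g₂ j k a) (hDo : IsOpen D)
    (hxs : DifferentiableOn ℂ xs D)
    (hchart : ∀ p ∈ D, xs p j = 1 ∧ xs p k = p.2 ∧
      ∀ i, i ≠ j → i ≠ k → eval (xs p) (pderiv i (f₁ + p.1.1 • g₂ + p.1.2 • g₀)) = 0)
    {p : (ℂ × ℂ) × ℂ} (hp : p ∈ D) (hzero : eval (xs p) (f₁ + p.1.1 • g₂ + p.1.2 • g₀) = 0)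
    (hcrit : eval (xs p) (pderiv k (f₁ + p.1.1 • g₂ + p.1.2 • g₀)) = 0)
    (hblock : ((hessianAt (f₁ + p.1.1 • g₂ + p.1.2 • g₀) (xs p)).submatrix
      (fun i : {i : Fin (n + 2) // i ≠ j ∧ i ≠ k} => i.1) (fun i : {i : Fin (n + 2) // i ≠ j ∧ i ≠ k} => i.1)).det ≠ 0)
    (hschur : deriv (fun u => eval (xs (p.1, u)) (pderiv k (f₁ + p.1.1 • g₂ + p.1.2 • g₀))) p.2 ≠ 0) :
    IsOrdinaryDoublePointOf (f₁ + p.1.1 • g₂ + p.1.2 • g₀) (xs p) := by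
  classical
  set F := f₁ + p.1.1 • g₂ + p.1.2 • g₀ with hF
  have hFhom : F.IsHomogeneous d := by
    rw [hF, MvPolynomial.smul_eq_C_mul, MvPolynomial.smul_eq_C_mul]
    exact (hf₁.add (hg₂.C_mul _)).add (hg₀.C_mul _)
  have hd : d ≠ 0 := by have := hD.one_le hf₁; omega
  obtain ⟨hxj, -, hpart⟩ := hchart p hp
  have hgrad : ∀ i, eval (xs p) (pderiv i F) = 0 :=
    (slice_singular_iff hFhom hd hD.1 hxj hpart).2 ⟨hzero, hcrit⟩
  obtain ⟨hwj, hwk, hrows, hrowk⟩ := hessianAt_mulVec_chartDeriv hDo hxs hchart hp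
  refine isOrdinaryDoublePointOf_of_schur hFhom (by rw [hxj]; exact one_ne_zero) hgrad
    ((block_injective_iff_det_ne_zero _ j k).2 hblock) hwj hwk hrows ?_
  rw [hrowk]
  exact hschur

/-- **The block of the Hessian stays non-degenerate along the chart near the base point.**  If `xs` is continuous at
`0 ∈ D` with `xs(0) = e_j` then, for `p = (μ, u)` near `0`, the `(∉{j,k})`-block of `Hess(F_μ)(xs(p))` has non-zero
determinant (`IsSymmetricA3Datum.det_block_hessianAt_ne_zero` at `p = 0`, and continuity of the entries
`∂ᵢ∂ᵢ'(f₁ + α g₂ + β g₀)(xs(p))`). [cite: VoisinHodgeII2003, §2.1.1 Lemma 2.7] [cite: ArnoldGuseinzadeVarchenko2012, Part I §5.2] -/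
theorem eventually_det_block_hessianAt_chart_ne_zero {a : Fin (n + 2) → ℂˣ} (hf₁ : f₁.IsHomogeneous d)
    (hD : IsSymmetricA3Datum f₁ g₀ g₂ j k a) (hxs0 : ContinuousAt xs 0) (hbase : xs 0 = Pi.single j 1) :
    ∀ᶠ p in 𝓝 (0 : (ℂ × ℂ) × ℂ),
      ((hessianAt (f₁ + p.1.1 • g₂ + p.1.2 • g₀) (xs p)).submatrix
        (fun i : {i : Fin (n + 2) // i ≠ j ∧ i ≠ k} => i.1) (fun i : {i : Fin (n + 2) // i ≠ j ∧ i ≠ k} => i.1)).det ≠ 0 := by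
  classical
  -- the block as a continuous matrix-valued function of `p`
  set M : (ℂ × ℂ) × ℂ → Matrix {i : Fin (n + 2) // i ≠ j ∧ i ≠ k} {i : Fin (n + 2) // i ≠ j ∧ i ≠ k} ℂ := fun p =>
    (hessianAt (f₁ + p.1.1 • g₂ + p.1.2 • g₀) (xs p)).submatrix (fun i => i.1) (fun i => i.1) with hM
  have hentry : ∀ p (i i' : {i : Fin (n + 2) // i ≠ j ∧ i ≠ k}), M p i i' =
      eval (xs p) (pderiv i.1 (pderiv i'.1 f₁)) + p.1.1 * eval (xs p) (pderiv i.1 (pderiv i'.1 g₂)) +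
        p.1.2 * eval (xs p) (pderiv i.1 (pderiv i'.1 g₀)) := by
    intro p i i'
    simp [hM, hessianAt, Matrix.submatrix_apply, map_add, smul_eval, (pderiv _).map_smul]
  have hMc : ContinuousAt M 0 := by
    refine continuousAt_pi.2 fun i => continuousAt_pi.2 fun i' => ?_
    simp only [hentry]
    have he : ∀ G : MvPolynomial (Fin (n + 2)) ℂ, ContinuousAt (fun p : (ℂ × ℂ) × ℂ => eval (xs p) G) 0 :=
      fun G => (MvPolynomial.continuous_eval G).continuousAt.comp hxs0
    exact ((he _).add ((continuous_fst.fst.continuousAt).mul (he _))).add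
      ((continuous_fst.snd.continuousAt).mul (he _))
  have hdet : ContinuousAt (fun p => (M p).det) 0 := (continuous_id.matrix_det).continuousAt.comp hMc
  have h0 : (M 0).det ≠ 0 := by
    have h := hD.det_block_hessianAt_ne_zero hf₁
    simp only [hM, Prod.fst_zero, Prod.snd_zero, zero_smul, add_zero, hbase]
    exact h
  exact hdet.eventually_ne h0

end HodgeTheory

end Literature.AlgebraicGeometry.HodgeTheory

end
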